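import Literature.NumberTheory.DiophantineGeometry.TerjanianEvenExponent
import HarnessLib

/-!
# Rotkiewicz's Jacobi-symbol law `(A(m) / A(n)) = (−1)^{[2u/n]}` for `A(n) = (xⁿ − yⁿ)/(x − y)`, `2 ∥ xy`

Topic `Literature/NumberTheory/DiophantineGeometry`; vocabulary of `TerjanianEvenExponent.lean`
(`Terjanian.Q n x y = Σ_{k<n} x^k y^{n−1−k}`), completing `Terjanian.jacobi_Q` (case `xy ≡ 1 (mod 4)`: `= (m/n)`)
and `CaoJacobiSymbolLaw.lean` (cases `4 ∣ x + y`, `4 ∣ xy`: `= 1`) by the remaining case `2 ∥ xy`. Source: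
A. Granville, *Primitive prime factors in second-order linear recurrence sequences*, Acta Arith. 155 (2012) 431–452
[Granville2012], §1c, verbatim: "In the most interesting case, when 2, but not 4, divides c, we have
`(x_m / x_n) = (−1)^{Λ(m/n)}` for all odd, coprime, positive integers `m` and `n > 1`, (3) where `Λ(m/n)` is the
length of the continued fraction for `m/n`" (attributed there to Rotkiewicz, Acta Arith. 42 (1983), Thm 2;
= [CaoZhenfu2024, §2.5 Ex. 6 ③]), with [Granville2012, eq. (6)], verbatim: "`Λ(k/m) ≡ [2u/m] (mod 2)` where
`uk ≡ 1 (mod m)`"; here `x_n = (rⁿ − sⁿ)/(r − s)`, `c = −rs`. Formalized (`rotkiewicz_jacobi_Q`): `r, s` coprime,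
`r` odd, `s ≡ 2 (mod 4)` (the other orientation by `Terjanian.Q_comm`), `m, n` coprime odd, `n ≥ 3`, ANY `u` with
`mu ≡ 1 (mod n)`: `(Q_m / Q_n) = (−1)^{[2u/n]}`. Proof (not Granville's Theorem 4, which runs through even indices
under `b ≡ 3 (mod 4)`): the odd-index descent of [CaoZhenfu2024, §2.5 Ex. 1] with signs — `Q_t ≡ 3 (mod 4)` for
odd `t ≥ 3`; `Q_n ∣ Q_m − (s^{nk})² Q_t` (`m = 2nk + t`, `t ≡ m (mod n)`, no sign); `Q_n ∣ Q_m + (s^a r^b)² Q_u`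
(`m + u ≡ 0 (mod 2n)`, sign `(−1/Q_n) = −1`); reciprocity between moduli `≡ 3 (mod 4)` (sign `−1`) — matched by
`[2u/n]`: invariant under `m ↦ t`, flipped by `u ↦ n − u` and by the swap `(m, n) ↦ (n, m)` (Granville's Lemma 5).
Consequence (`rotkiewicz_prime_mul_Q_ne_sq`): for a prime `p ≥ 5` an odd `m` with `(m/p)(Q_m/Q_p) = −1` exists
(`u` a non-residue below `p/2`), so `p · Q_p(x, y)` is not a square when `2 ∥ xy` — the `2 ∥ xy` case of
[CaoZhenfu2024, §2.5 Ex. 5] = [Cao1986] (`cao1986_parity`), used in `TerjanianTheoremSignaturePP2.lean`.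
Everything PROVED; no named fact. Literature seat of the venture cell `pub-abcsig` (lit g14), 2026-08-25.
-/

namespace Literature.NumberTheory.DiophantineGeometry

open Finset Terjanian
open scoped NumberTheorySymbols

namespace Rotkiewicz

variable {r s : ℤ}

/-- In `ZMod 4`: `Q_n(r, s) = 3` for odd `n ≥ 3`, `r` odd, `s ≡ 2 (mod 4)` (only the terms `r^{n−1}` and
`2 r^{n−2}` survive). [folklore] -/
private theorem Q_zmod_four {n : ℕ} (hn : Odd n) (h3 : 3 ≤ n) (hr : Odd r) (hs : s % 4 = 2) :
    ((Q n r s : ℤ) : ZMod 4) = 3 := by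
  obtain ⟨k, hk⟩ : ∃ k, n = k + 2 := ⟨n - 2, by omega⟩
  have hs2 : (s : ZMod 4) = 2 := ((ZMod.intCast_eq_intCast_iff_dvd_sub 2 s 4).mpr (by omega)).symm
  have h4 : (4 : ZMod 4) = 0 := by decide
  obtain ⟨j, rfl⟩ := hr
  have hr1 : ((2 * j + 1 : ℤ) : ZMod 4) ^ 2 = 1 := by push_cast; linear_combination (j ^ 2 + j) * h4
  obtain ⟨a, ha⟩ := hn
  have hrk : ((2 * j + 1 : ℤ) : ZMod 4) ^ (k + 1) = 1 := by
    rw [show k + 1 = 2 * a by omega, pow_mul, hr1, one_pow]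
  have hrk' : ((2 * j + 1 : ℤ) : ZMod 4) ^ k = (2 * j + 1 : ℤ) := by
    rw [show k = 2 * (a - 1) + 1 by omega, pow_succ, pow_mul, hr1, one_pow, one_mul]
  unfold Q
  push_cast
  rw [hk, Finset.sum_range_succ, Finset.sum_range_succ, Finset.sum_eq_zero]
  · push_cast at hrk hrk'
    rw [show k + 2 - 1 - k = 1 by omega, show k + 2 - 1 - (k + 1) = 0 by omega, pow_one, pow_zero, mul_one,
      hrk, hrk', hs2, zero_add]
    linear_combination j * h4
  · intro i hi
    rw [Finset.mem_range] at hi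
    rw [show k + 2 - 1 - i = (k - 1 - i) + 2 by omega, pow_add, hs2]
    have : (2 : ZMod 4) ^ 2 = 0 := by decide
    rw [this, mul_zero, mul_zero]

/-- `Q_n(r, s) ≡ 3 (mod 4)` for odd `n ≥ 3`, `r` odd, `s ≡ 2 (mod 4)` ([Granville2012, §2b]: "We also have
`x_n ≡ 3 (mod 4)` for all `n ≥ 2`", here for odd `n` and as `natAbs % 4`). [cite: Granville2012, §2b] -/
theorem natAbs_Q_mod_four {n : ℕ} (hn : Odd n) (h3 : 3 ≤ n) (hr : Odd r) (hs : s % 4 = 2)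
    (hne : r ≠ s) : (Q n r s).natAbs % 4 = 3 := by
  have h := Q_zmod_four hn h3 hr hs
  rw [← natAbs_Q_cast hn hne, Int.cast_natCast] at h
  have := (ZMod.natCast_eq_natCast_iff' (Q n r s).natAbs 3 4).mp (by rw [Nat.cast_ofNat]; exact h)
  simpa using this

/-- For `m = 2nk + t`: `Q_n ∣ Q_m − (s^{nk})² Q_t`. [folklore] -/
private theorem Q_dvd_reduce₁ (hne : r ≠ s) {n k t : ℕ} :
    Q n r s ∣ Q (2 * n * k + t) r s - (s ^ (n * k)) ^ 2 * Q t r s := by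
  have hrs : r - s ≠ 0 := sub_ne_zero.mpr hne
  rw [← mul_dvd_mul_iff_right hrs, Q_mul_sub]
  have hfac : (Q (2 * n * k + t) r s - (s ^ (n * k)) ^ 2 * Q t r s) * (r - s) =
      r ^ t * ((r ^ n) ^ (2 * k) - (s ^ n) ^ (2 * k)) := by
    calc _ = Q (2 * n * k + t) r s * (r - s) - (s ^ (n * k)) ^ 2 * (Q t r s * (r - s)) := by ring
      _ = (r ^ (2 * n * k + t) - s ^ (2 * n * k + t)) - (s ^ (n * k)) ^ 2 * (r ^ t - s ^ t) := by
          rw [Q_mul_sub, Q_mul_sub]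
      _ = _ := by rw [← pow_mul, ← pow_mul]; ring
  rw [hfac]
  exact dvd_mul_of_dvd_right (sub_dvd_pow_sub_pow _ _ _) _

/-- For `n = u + 2b`, `m = n + 2a`, `2a + u = n j`: `Q_n ∣ Q_m + (s^a r^b)² Q_u`. [folklore] -/
private theorem Q_dvd_reduce₂ (hne : r ≠ s) {u a b j : ℕ} (hj : 2 * a + u = (u + 2 * b) * j) :
    Q (u + 2 * b) r s ∣ Q (u + 2 * b + 2 * a) r s + (s ^ a * r ^ b) ^ 2 * Q u r s := by
  have hrs : r - s ≠ 0 := sub_ne_zero.mpr hne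
  rw [← mul_dvd_mul_iff_right hrs, Q_mul_sub]
  have hfac : (Q (u + 2 * b + 2 * a) r s + (s ^ a * r ^ b) ^ 2 * Q u r s) * (r - s) =
      r ^ (2 * b) * ((r ^ (u + 2 * b)) ^ j - (s ^ (u + 2 * b)) ^ j) +
        s ^ (2 * a) * (r ^ (u + 2 * b) - s ^ (u + 2 * b)) := by
    calc _ = Q (u + 2 * b + 2 * a) r s * (r - s) + (s ^ a * r ^ b) ^ 2 * (Q u r s * (r - s)) := by ring
      _ = (r ^ (u + 2 * b + 2 * a) - s ^ (u + 2 * b + 2 * a)) + (s ^ a * r ^ b) ^ 2 * (r ^ u - s ^ u) := by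
          rw [Q_mul_sub, Q_mul_sub]
      _ = _ := by rw [← pow_mul, ← pow_mul, ← hj]; ring
  rw [hfac]
  exact dvd_add (dvd_mul_of_dvd_right (sub_dvd_pow_sub_pow _ _ _) _) (dvd_mul_left _ _)

/-- For odd coprime `m`, `n` with `n ≥ 3`: there is an odd `t < n`, coprime to `n`, with EITHER `t ≡ m (mod n)` and
`(Q_m / Q_n) = (Q_t / Q_n)`, OR `t + m ≡ 0 (mod n)` and `(Q_m / Q_n) = −(Q_t / Q_n)`. [folklore] -/
private theorem jacobi_reduce (hne : r ≠ s) (hcop : IsCoprime r s) (hr : Odd r) (hs : s % 4 = 2)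
    {m n : ℕ} (hm : Odd m) (hn : Odd n) (hmn : Nat.Coprime m n) (h3n : 3 ≤ n) :
    ∃ t : ℕ, t < n ∧ Odd t ∧ Nat.Coprime t n ∧
      ((t % n = m % n ∧ J(Q m r s | (Q n r s).natAbs) = J(Q t r s | (Q n r s).natAbs)) ∨
       ((t + m) % n = 0 ∧ J(Q m r s | (Q n r s).natAbs) = -J(Q t r s | (Q n r s).natAbs))) := by
  set N := (Q n r s).natAbs with hN
  have hNZ : (N : ℤ) = Q n r s := natAbs_Q_cast hn hne
  have hN4 : N % 4 = 3 := natAbs_Q_mod_four hn h3n hr hs hne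
  have hNodd : Odd N := Nat.odd_iff.mpr (by omega)
  have hn0 : n ≠ 0 := by omega
  have hgr : IsCoprime r (Q n r s) := isCoprime_Q_left hn0 hcop
  have hgs : IsCoprime s (Q n r s) := isCoprime_Q_right hn0 hcop
  set q := m / (2 * n) with hq
  set t := m % (2 * n) with ht
  have hmt : m = 2 * n * q + t := (Nat.div_add_mod m (2 * n)).symm
  have ht2n : t < 2 * n := Nat.mod_lt _ (by omega)
  have hmt' : m = 2 * (n * q) + t := by rw [hmt]; ring
  have htodd : Odd t := by obtain ⟨a, ha⟩ := hm; exact ⟨a - n * q, by omega⟩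
  have htcop : Nat.Coprime t n := by
    rw [← Nat.isCoprime_iff_coprime] at hmn ⊢
    have : (t : ℤ) = (m : ℤ) + (n : ℤ) * (-(2 * q : ℤ)) := by push_cast [hmt]; ring
    rw [this]
    exact hmn.add_mul_left_left _
  have htn : t ≠ n := fun h => by
    have := Nat.Coprime.eq_one_of_dvd (Nat.Coprime.symm hmn) ⟨2 * q + 1, by rw [hmt, h]; ring⟩; omega
  rcases lt_or_gt_of_ne htn with htl | htg
  · refine ⟨t, htl, htodd, htcop, Or.inl ⟨?_, ?_⟩⟩
    · rw [hmt', show 2 * (n * q) + t = t + n * (2 * q) by ring, Nat.add_mul_mod_self_left]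
    · have hdvd := Q_dvd_reduce₁ hne (r := r) (s := s) (n := n) (k := q) (t := t)
      rw [show 2 * n * q + t = m by omega] at hdvd
      have hmod : Q m r s % (N : ℤ) = ((s ^ (n * q)) ^ 2 * Q t r s) % (N : ℤ) :=
        Int.ModEq.symm (Int.modEq_iff_dvd.mpr (by rw [hNZ]; simpa using hdvd))
      rw [jacobiSym.mod_left' hmod, jacobiSym.mul_left, jacobiSym.sq_one' (gcd_natAbs_Q_eq_one hgs.pow_left),
        one_mul]
  · set u := 2 * n - t with hu
    have hul : u < n := by omega
    have huodd : Odd u := by obtain ⟨a, ha⟩ := htodd; exact ⟨n - a - 1, by omega⟩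
    have hut : u + t = 2 * n := by omega
    have hucop : Nat.Coprime u n := by
      rw [← Nat.isCoprime_iff_coprime] at htcop ⊢
      have : (u : ℤ) = -(t : ℤ) + (n : ℤ) * 2 := by
        have : (u : ℤ) + t = 2 * n := by exact_mod_cast hut
        linarith
      rw [this]
      exact htcop.neg_left.add_mul_left_left _
    refine ⟨u, hul, huodd, hucop, Or.inr ⟨?_, ?_⟩⟩
    · rw [hmt', show u + (2 * (n * q) + t) = (u + t) + n * (2 * q) by ring, Nat.add_mul_mod_self_left, hut,
        Nat.mul_mod_left]
    · obtain ⟨b, hb⟩ : ∃ b, n = u + 2 * b := by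
        obtain ⟨a1, ha1⟩ := hn; obtain ⟨a2, ha2⟩ := huodd; exact ⟨a1 - a2, by omega⟩
      have hnm : n ≤ m := by omega
      obtain ⟨a, ha⟩ : ∃ a, m = n + 2 * a := by
        obtain ⟨a1, ha1⟩ := hm; obtain ⟨a2, ha2⟩ := hn; exact ⟨a1 - a2, by omega⟩
      have hj : 2 * a + u = (u + 2 * b) * (2 * q + 1) := by nlinarith [hmt, hut, ha, hb]
      have hdvd := Q_dvd_reduce₂ hne (r := r) (s := s) hj
      rw [← hb, ← ha] at hdvd
      have hmod : Q m r s % (N : ℤ) = (-((s ^ a * r ^ b) ^ 2 * Q u r s)) % (N : ℤ) :=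
        Int.ModEq.symm (Int.modEq_iff_dvd.mpr (by rw [hNZ, sub_neg_eq_add]; exact hdvd))
      rw [jacobiSym.mod_left' hmod, neg_eq_neg_one_mul, jacobiSym.mul_left, jacobiSym.mul_left,
        jacobiSym.at_neg_one hNodd, ZMod.χ₄_nat_three_mod_four hN4,
        jacobiSym.sq_one' (gcd_natAbs_Q_eq_one ((hgs.pow_left (m := a)).mul_left (hgr.pow_left (m := b)))),
        one_mul, neg_one_mul]

/-- `(−1)^{[2u/n]}` only depends on `u mod n`. [folklore] -/
private theorem sign_mod (u : ℕ) {n : ℕ} (hn : 0 < n) :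
    (-1 : ℤ) ^ (2 * u / n) = (-1) ^ (2 * (u % n) / n) := by
  conv_lhs => rw [← Nat.mod_add_div u n]
  rw [show 2 * (u % n + n * (u / n)) = 2 * (u % n) + n * (2 * (u / n)) by ring,
    Nat.add_mul_div_left _ _ hn, pow_add, pow_mul, neg_one_sq, one_pow, mul_one]

/-- `a / n = 1` for `n ≤ a < 2n`. [folklore] -/
private theorem div_eq_one {a n : ℕ} (hn : 0 < n) (h1 : n ≤ a) (h2 : a < 2 * n) : a / n = 1 := by
  have := (Nat.le_div_iff_mul_le hn).mpr (show 1 * n ≤ a by omega)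
  have := (Nat.div_lt_iff_lt_mul hn).mpr h2
  omega

/-- `a % n = 1` read in `ZMod n` (`n ≥ 2`). [folklore] -/
private theorem cast_eq_one_iff {a n : ℕ} (hn : 1 < n) : ((a : ℕ) : ZMod n) = 1 ↔ a % n = 1 := by
  rw [show (1 : ZMod n) = ((1 : ℕ) : ZMod n) by rw [Nat.cast_one], ZMod.natCast_eq_natCast_iff',
    Nat.mod_eq_of_lt hn]

/-- The flip: if `mu ≡ 1`, `t + m ≡ 0 (mod n)` (`n ≥ 3` odd) then `n − (u mod n)` is an inverse of `t` and
`(−1)^{[2(n − u mod n)/n]} = −(−1)^{[2u/n]}`. [folklore] -/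
private theorem sign_flip {m t u n : ℕ} (hn : Odd n) (h3n : 3 ≤ n) (hu : m * u % n = 1) (ht : (t + m) % n = 0) :
    t * (n - u % n) % n = 1 ∧ (-1 : ℤ) ^ (2 * (n - u % n) / n) = -(-1) ^ (2 * u / n) := by
  have hn0 : 0 < n := by omega
  have hvn : u % n < n := Nat.mod_lt _ hn0
  have hmu : ((m : ℕ) : ZMod n) * u = 1 := by rw [← Nat.cast_mul, cast_eq_one_iff (by omega), hu]
  haveI : Fact (1 < n) := ⟨by omega⟩
  have hv0 : 0 < u % n := by
    refine Nat.pos_of_ne_zero fun h => zero_ne_one (α := ZMod n) ?_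
    rw [← hmu, ← ZMod.natCast_mod u, h, Nat.cast_zero, mul_zero]
  constructor
  · rw [← cast_eq_one_iff (by omega)]
    have htm : ((t : ℕ) : ZMod n) = -m :=
      eq_neg_of_add_eq_zero_left (by rw [← Nat.cast_add, ZMod.natCast_eq_zero_iff]; exact Nat.dvd_of_mod_eq_zero ht)
    push_cast [hvn.le]
    rw [ZMod.natCast_self, zero_sub, ZMod.natCast_mod, htm, neg_mul_neg, hmu]
  · rw [sign_mod u hn0]
    obtain ⟨k, hk⟩ := hn
    rcases lt_or_gt_of_ne (show 2 * (u % n) ≠ n by omega) with h | h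
    · rw [Nat.div_eq_of_lt h, div_eq_one hn0 (by omega) (by omega)]; norm_num
    · rw [div_eq_one hn0 h.le (by omega), Nat.div_eq_of_lt (by omega)]; norm_num

/-- The swap (Granville's Lemma 5): for coprime odd `m, n ≥ 3` and inverses `mu ≡ 1 (mod n)`, `nv ≡ 1 (mod m)`:
`(−1)^{[2u/n]} = −(−1)^{[2v/m]}`. [folklore] -/
private theorem sign_swap {m n u v : ℕ} (hm : Odd m) (hn : Odd n) (h3m : 3 ≤ m) (h3n : 3 ≤ n)
    (hu : m * u % n = 1) (hv : n * v % m = 1) :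
    (-1 : ℤ) ^ (2 * u / n) = -(-1) ^ (2 * v / m) := by
  have hn0 : 0 < n := by omega
  have hm0 : 0 < m := by omega
  haveI : Fact (1 < m) := ⟨by omega⟩
  rw [sign_mod u hn0, sign_mod v hm0]
  set u' := u % n with hu'
  set v' := v % m with hv'
  have hu1 : m * u' % n = 1 := by rw [hu', Nat.mul_mod, Nat.mod_mod, ← Nat.mul_mod, hu]
  have hv1 : ((n : ℕ) : ZMod m) * v' = 1 := by
    rw [hv', ZMod.natCast_mod, ← Nat.cast_mul, cast_eq_one_iff (by omega), hv]
  have hu'n : u' < n := Nat.mod_lt _ hn0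
  have hv'm : v' < m := Nat.mod_lt _ hm0
  -- `m u' = n w + 1` with `0 < w < m`, and `v' = m − w`
  obtain ⟨w, hw⟩ : ∃ w, m * u' = n * w + 1 := ⟨m * u' / n, by have := Nat.div_add_mod (m * u') n; omega⟩
  have hw0 : 0 < w := by
    refine Nat.pos_of_ne_zero fun h => ?_
    rw [h, mul_zero, zero_add] at hw
    have := Nat.eq_one_of_mul_eq_one_right hw; omega
  have hwm : w < m := by nlinarith
  have hv'eq : v' = m - w := by
    have h1 : ((n : ℕ) : ZMod m) * ((m - w : ℕ) : ZMod m) = 1 := by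
      have hc : ((m * u' : ℕ) : ZMod m) = ((n * w + 1 : ℕ) : ZMod m) := by rw [hw]
      push_cast [hwm.le] at hc ⊢
      rw [ZMod.natCast_self, zero_mul] at hc
      rw [ZMod.natCast_self]; linear_combination hc
    have := (ZMod.natCast_eq_natCast_iff' _ _ _).mp
      ((IsUnit.of_mul_eq_one _ hv1).mul_left_cancel (hv1.trans h1.symm))
    rwa [Nat.mod_eq_of_lt hv'm, Nat.mod_eq_of_lt (by omega : m - w < m)] at this
  rw [hv'eq]
  obtain ⟨km, hkm⟩ := hm; obtain ⟨kn, hkn⟩ := hn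
  rcases lt_or_gt_of_ne (show 2 * u' ≠ n by omega) with h | h
  · -- `2u' < n ⇒ 2w < m ⇒ 2(m − w) ≥ m`
    have h2w : 2 * w < m := by
      by_contra hc
      have e1 : n * m ≤ n * (2 * w) := Nat.mul_le_mul_left _ (not_lt.mp hc)
      have e2 : m * (2 * u') < m * n := Nat.mul_lt_mul_of_pos_left h hm0
      nlinarith
    rw [Nat.div_eq_of_lt h, div_eq_one hm0 (by omega) (by omega)]; norm_num
  · have h2w : m < 2 * w := by
      by_contra hc
      have e1 : n * (2 * w) ≤ n * (m - 1) := Nat.mul_le_mul_left _ (by omega : 2 * w ≤ m - 1)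
      have e2 : m * n < m * (2 * u') := Nat.mul_lt_mul_of_pos_left h hm0
      have e3 : n * (m - 1) + n = n * m := by zify [show 1 ≤ m by omega]; ring
      nlinarith
    rw [div_eq_one hn0 h.le (by omega), Nat.div_eq_of_lt (by omega)]; norm_num

/-- **Rotkiewicz's law** in Granville's form ([Granville2012, §1c eq. (3) with eq. (6)]; Rotkiewicz, Acta Arith. 42
(1983), Thm 2; [CaoZhenfu2024, §2.5 Ex. 6 ③]): for coprime integers `r, s` with `r` odd and `s ≡ 2 (mod 4)` (so
`2 ∥ rs`; the symmetric orientation via `Terjanian.Q_comm`), coprime odd naturals `m` and `n ≥ 3`, and any natural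
`u` with `mu ≡ 1 (mod n)`, the Jacobi symbol `(Q_m(r,s) / Q_n(r,s)) = (−1)^{[2u/n]}` (`= (−1)^{Λ(m/n)}`, `Λ` the
length of the continued fraction of `m/n`, by [Granville2012, (6)]).
[cite: Granville2012, §1c eq. (3) and §3a eq. (6) (Rotkiewicz 1983, Thm 2)] -/
theorem rotkiewicz_jacobi_Q (hne : r ≠ s) (hcop : IsCoprime r s) (hr : Odd r) (hs : s % 4 = 2)
    {m n : ℕ} (hm : Odd m) (hn : Odd n) (h3n : 3 ≤ n) (hmn : Nat.Coprime m n) {u : ℕ} (hu : m * u % n = 1) :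
    J(Q m r s | (Q n r s).natAbs) = (-1) ^ (2 * u / n) := by
  suffices H : ∀ S : ℕ, ∀ m n : ℕ, m + n ≤ S → Odd m → Odd n → 3 ≤ n → Nat.Coprime m n → ∀ u : ℕ,
      m * u % n = 1 → J(Q m r s | (Q n r s).natAbs) = (-1) ^ (2 * u / n) from H _ m n le_rfl hm hn h3n hmn u hu
  intro S; induction S with
  | zero => intro m n hS hm; exfalso; obtain ⟨a, ha⟩ := hm; omega
  | succ S ih =>
    intro m n hS hm hn h3n hmn u hu
    have hn0 : 0 < n := by omega
    rcases eq_or_ne m 1 with rfl | hm1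
    · -- `m = 1`: `u ≡ 1`, `[2u/n]` even
      rw [Q_one, jacobiSym.one_left, sign_mod u hn0, show u % n = 1 by simpa using hu,
        Nat.div_eq_of_lt (by omega), pow_zero]
    have h3m : 3 ≤ m := by obtain ⟨a, ha⟩ := hm; omega
    have hmn' : m ≠ n := by rintro rfl; exact absurd ((Nat.coprime_self _).mp hmn) (by omega)
    -- one descent step for a pair `(M, n')` with `M > n' ≥ 3`, `M + n' ≤ S + 1`
    have step : ∀ M n' u' : ℕ, M + n' ≤ S + 1 → n' < M → Odd M → Odd n' → 3 ≤ n' → Nat.Coprime M n' →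
        M * u' % n' = 1 → J(Q M r s | (Q n' r s).natAbs) = (-1) ^ (2 * u' / n') := by
      intro M n' u' hS' hlt hM hn' h3n' hMn hu'
      obtain ⟨t, htn, htodd, htcop, hcase⟩ := jacobi_reduce hne hcop hr hs hM hn' hMn h3n'
      rcases hcase with ⟨htm, hJ⟩ | ⟨htm, hJ⟩
      · rw [hJ]
        refine ih t n' (by omega) htodd hn' h3n' htcop u' ?_
        rw [Nat.mul_mod, htm, ← Nat.mul_mod, hu']
      · obtain ⟨hinv, hsign⟩ := sign_flip hn' h3n' hu' htm
        rw [hJ, ih t n' (by omega) htodd hn' h3n' htcop _ hinv, hsign, neg_neg]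
    rcases lt_or_gt_of_ne hmn' with hlt | hgt
    · -- `m < n`: reciprocity (both `≡ 3 (mod 4)`), then the step for `(n, m)` with an inverse `v` of `n` mod `m`
      obtain ⟨v, -, hv⟩ := Nat.exists_mul_mod_eq_one_of_coprime hmn.symm (show 1 < m by omega)
      rw [← natAbs_Q_cast hm hne, jacobiSym.quadratic_reciprocity_three_mod_four
        (natAbs_Q_mod_four hm h3m hr hs hne) (natAbs_Q_mod_four hn h3n hr hs hne), natAbs_Q_cast hn hne,
        step n m v (by omega) hlt hn hm h3m hmn.symm hv, sign_swap hm hn h3m h3n hu hv]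
    · exact step m n u (by omega) hgt hm hn h3n hmn hu

/-- For a prime `p ≥ 5` there are an odd `m` prime to `p` and an inverse `u` of `m` mod `p` with
`(m / p) · (−1)^{[2u/p]} = −1`: take `u` a quadratic non-residue with `0 < 2u < p` (one exists: otherwise `2` and
`(p−1)/2`, hence `−1`, hence every non-zero class would be a square) and `m` an odd representative of `u⁻¹`
(`(m/p) = (u/p) = −1`, `[2u/p] = 0`). [folklore] -/
private theorem witness {p : ℕ} (hp : p.Prime) (h5 : 5 ≤ p) :
    ∃ m u : ℕ, Odd m ∧ Nat.Coprime m p ∧ m * u % p = 1 ∧ J((m : ℤ) | p) * (-1) ^ (2 * u / p) = -1 := by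
  haveI := Fact.mk hp
  have hp2 : p ≠ 2 := by omega
  have hpodd : Odd p := hp.odd_of_ne_two hp2
  -- a non-residue `u` with `0 < u`, `2u < p`
  obtain ⟨u, hu0, hup, hnr⟩ : ∃ u : ℕ, 0 < u ∧ 2 * u < p ∧ ¬ IsSquare ((u : ℕ) : ZMod p) := by
    by_contra hall
    simp only [not_exists, not_and, not_not] at hall
    have hneg1 : IsSquare (-1 : ZMod p) := by
      have e : ((2 : ℕ) : ZMod p) * (((p - 1) / 2 : ℕ) : ZMod p) = -1 := by
        have hp1 : 2 * ((p - 1) / 2) = p - 1 := by obtain ⟨k, hk⟩ := hpodd; omega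
        rw [← Nat.cast_mul, hp1, Nat.cast_sub hp.one_le, ZMod.natCast_self, Nat.cast_one, zero_sub]
      rw [← e]
      exact (hall 2 (by omega) (by omega)).mul (hall _ (by omega) (by omega))
    have hsqall : ∀ w : ℕ, 0 < w → w < p → IsSquare ((w : ℕ) : ZMod p) := by
      intro w hw0 hwp
      rcases lt_or_gt_of_ne (show 2 * w ≠ p by obtain ⟨k, hk⟩ := hpodd; omega) with h | h
      · exact hall w hw0 h
      · have e : ((w : ℕ) : ZMod p) = -1 * ((p - w : ℕ) : ZMod p) := by
          rw [Nat.cast_sub hwp.le, ZMod.natCast_self, zero_sub]; ring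
        rw [e]
        exact hneg1.mul (hall _ (by omega) (by omega))
    obtain ⟨a, ha⟩ := FiniteField.exists_nonsquare (F := ZMod p) (by rw [ZMod.ringChar_zmod_n]; exact hp2)
    refine ha ?_
    rw [← ZMod.natCast_zmod_val a]
    exact hsqall a.val (Nat.pos_of_ne_zero fun h => ha ((ZMod.val_eq_zero a).mp h ▸ IsSquare.zero))
      (ZMod.val_lt a)
  -- `m`: an odd representative of `u⁻¹ mod p`
  have hucop : Nat.Coprime u p := (Nat.coprime_of_lt_prime (by omega) (by omega) hp).symm
  obtain ⟨m₀, -, hm₀⟩ := Nat.exists_mul_mod_eq_one_of_coprime hucop hp.one_lt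
  obtain ⟨m, hmodd, hm⟩ : ∃ m : ℕ, Odd m ∧ m * u % p = 1 := by
    rcases Nat.even_or_odd m₀ with he | ho
    · refine ⟨m₀ + p, he.add_odd hpodd, ?_⟩
      rw [add_mul, Nat.add_mul_mod_self_left, mul_comm, hm₀]
    · exact ⟨m₀, ho, by rw [mul_comm, hm₀]⟩
  have hmu : m * u ≡ 1 [MOD p] := by rw [Nat.ModEq, hm, Nat.mod_eq_of_lt hp.one_lt]
  refine ⟨m, u, hmodd, Nat.coprime_of_mul_modEq_one u hmu, hm, ?_⟩
  -- `(m / p) = (u / p) = −1` and `[2u/p] = 0`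
  rw [Nat.div_eq_of_lt hup, pow_zero, mul_one, ← jacobiSym.legendreSym.to_jacobiSym]
  have hu1 : legendreSym p u = -1 := (legendreSym.eq_neg_one_iff' (p := p)).mpr hnr
  have hprod : legendreSym p m * legendreSym p u = 1 := by
    rw [← legendreSym.mul, legendreSym.mod, show ((m : ℤ) * u) % (p : ℤ) = 1 by exact_mod_cast hm,
      legendreSym.at_one]
  rw [hu1, mul_neg_one] at hprod
  linarith

/-- **`p · Q_p(x, y)` is not a square when `2 ∥ xy`** (`p ≥ 5` prime, `x, y` coprime): the `2 ∥ xy` case of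
[CaoZhenfu2024, §2.5 Ex. 5] = [Cao1986], by Rotkiewicz's law — with `m, u` as in `witness`,
`(Q_m / p Q_p) = (m x^{m−1} / p)(Q_m / Q_p) = (m / p)(−1)^{[2u/p]} = −1`, while `(Q_m / y²) = (Q_m / y)²`.
[cite: Granville2012, §1c eq. (3) (Rotkiewicz); CaoZhenfu2024, Chap. 2 §2.5 Ex. 5–6 (the `2 ∥ xy` case)] -/
theorem rotkiewicz_prime_mul_Q_ne_sq {p : ℕ} (hp : p.Prime) (h5 : 5 ≤ p) (hne : r ≠ s) (hcop : IsCoprime r s)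
    (h2 : (Odd r ∧ s % 4 = 2) ∨ (Odd s ∧ r % 4 = 2)) (y : ℤ) : (p : ℤ) * Q p r s ≠ y ^ 2 := by
  wlog h : Odd r ∧ s % 4 = 2 generalizing r s
  · rw [Q_comm]; exact this hne.symm hcop.symm (Or.inl (h2.resolve_left h)) (h2.resolve_left h)
  obtain ⟨hr, hs⟩ := h
  intro heq
  haveI := Fact.mk hp
  have hp2 : p ≠ 2 := by omega
  have hpodd : Odd p := hp.odd_of_ne_two hp2
  have hpZ : Prime (p : ℤ) := Nat.prime_iff_prime_int.mp hp
  have hUpos : 0 < Q p r s := Q_pos hpodd hne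
  -- `p ∣ y`, so `p ∣ Q_p`, so `p ∣ r − s` (Fermat) and `p ∤ r`
  obtain ⟨y₁, rfl⟩ : (p : ℤ) ∣ y := hpZ.dvd_of_dvd_pow (by rw [← heq]; exact dvd_mul_right _ _)
  have hpU : (p : ℤ) ∣ Q p r s :=
    ⟨y₁ ^ 2, mul_left_cancel₀ (by exact_mod_cast hp.ne_zero : (p : ℤ) ≠ 0) (by rw [heq]; ring)⟩
  have hprs : (p : ℤ) ∣ r - s := by
    have hz : ((Q p r s : ℤ) : ZMod p) = 0 := (ZMod.intCast_zmod_eq_zero_iff_dvd _ p).mpr hpU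
    have hmul : ((Q p r s * (r - s) : ℤ) : ZMod p) = ((r - s : ℤ) : ZMod p) := by
      rw [Q_mul_sub]; push_cast; rw [ZMod.pow_card, ZMod.pow_card]
    rw [Int.cast_mul, hz, zero_mul] at hmul
    exact (ZMod.intCast_zmod_eq_zero_iff_dvd _ p).mp hmul.symm
  have hpr : ¬ (p : ℤ) ∣ r := fun hr' =>
    hpZ.not_unit (hcop.isUnit_of_dvd' hr' (by simpa using dvd_sub hr' hprs))
  -- the witness `m`, `u`; `(Q_m / p) = (m r^{m−1} / p) = (m / p)`
  obtain ⟨m, u, hmodd, hmcop, hmu, hprod⟩ := witness hp h5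
  have hJp : J(Q m r s | p) = J((m : ℤ) | p) := by
    have hsr : (s : ZMod p) = (r : ZMod p) := (ZMod.intCast_eq_intCast_iff_dvd_sub s r p).mpr hprs
    have hz : ((Q m r s : ℤ) : ZMod p) = ((m * r ^ (m - 1) : ℤ) : ZMod p) := by
      unfold Q; push_cast; simp_rw [hsr]; rw [geom_sum₂_self]
    have hmod : Q m r s % (p : ℤ) = (m * r ^ (m - 1)) % (p : ℤ) := (ZMod.intCast_eq_intCast_iff _ _ _).mp hz
    obtain ⟨k, hk⟩ := hmodd
    rw [jacobiSym.mod_left' hmod, jacobiSym.mul_left, show m - 1 = k * 2 by omega, pow_mul,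
      jacobiSym.sq_one' ?_, mul_one]
    exact Int.isCoprime_iff_gcd_eq_one.mp ((hpZ.coprime_iff_not_dvd).mpr hpr).symm.pow_left
  -- Rotkiewicz's law and two evaluations of `(Q_m / (p Q_p).natAbs)`
  have hlaw := rotkiewicz_jacobi_Q hne hcop hr hs hmodd hpodd (by omega) hmcop hmu
  haveI : NeZero (Q p r s).natAbs := ⟨Int.natAbs_ne_zero.mpr hUpos.ne'⟩
  haveI : NeZero p := ⟨hp.ne_zero⟩
  have h1 : J(Q m r s | ((p : ℤ) * Q p r s).natAbs) = -1 := by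
    rw [Int.natAbs_mul, Int.natAbs_natCast, jacobiSym.mul_right, hJp, hlaw, hprod]
  rw [heq, Int.natAbs_pow, jacobiSym.pow_right] at h1
  nlinarith [sq_nonneg (J(Q m r s | ((p : ℤ) * y₁).natAbs))]

end Rotkiewicz

end Literature.NumberTheory.DiophantineGeometry
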